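import Mathlib
import Summits.KontsevichZagierPeriods.KontsevichZagierPeriods.Theorems.InverseLandauTateFamilyKernelStubLinExact

/-!
# Crux `TateFamilyKernel` (stmt-KontsevichZagierPeriods-9130), line `Sketch`: stub `stub_gpPolyIntegral`

Step GP3a of the graph-pencil class (`Q = 1 − ϖ·(u(z₂) + βz₁)`, `u ∈ ℚ[s]`, `β ∈ ℚ`,
numerator `P ∈ ℚ[z₁, z₂]`) of the lead's skeleton of the crux
`Summit.KontsevichZagierPeriods.KontsevichZagierPeriods.Theses.InverseLandau.TateFamilyKernel`:
the single-branch integral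

  `∫_{σ ∈ (s,1)} P((y − u(σ))/β, σ) dσ`

is, for `s ≤ 1`, the value at `(y, s)` of ONE polynomial `H ∈ ℚ[y, s]` (variables `X 0 = y`,
`X 1 = s`). Elementary: the integrand is the real evaluation at `(y, σ)` of the substituted
polynomial `P̂ = P(β⁻¹(X 0 − u(X 1)), X 1) ∈ ℚ[X 0, X 1]` (`GpPolyIntegral.exists_integrand`; no
hypothesis on `β` is needed because Lean's `a / 0 = 0` matches `β⁻¹ = 0`); every `Q ∈ ℚ[X 0, X 1]`
has a formal antiderivative `F` in `X 1` with rational coefficients, `∂₁ F = Q`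
(`GpPolyIntegral.exists_pderiv_eq`, termwise `∫ S^j dS = S^{j+1}/(j+1)`); and by the fundamental
theorem of calculus (`LinExact.hasDerivAt_aeval_snd`: `d/dσ F(y, σ) = (∂₁F)(y, σ)`)
`∫_{(s,1)} Q(y, σ) dσ = F(y, 1) − F(y, s)` for `s ≤ 1`, which is the evaluation of
`H = F(X 0, 1) − F ∈ ℚ[X 0, X 1]` (`GpPolyIntegral.exists_integral_eq`). The restriction `s ≤ 1` is
necessary: for `s > 1` the set integral is `0` while `F(y,1) − F(y,s)` is not, in general.

References: Kontsevich–Zagier 2001, §1.2 (an elementary step of one test class of the period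
conjecture). Mathlib and the landed linear-class file `…StubLinExact` (helper
`LinExact.hasDerivAt_aeval_snd`) only; no named fact, no new definition. Helpers live in the
sub-namespace `GpPolyIntegral`.
-/

noncomputable section

open MeasureTheory Set MvPolynomial

namespace Summit.KontsevichZagierPeriods.InverseLandau.TateFamilyKernel.Descent

namespace GpPolyIntegral

/-! ### Formal antiderivative in the second variable -/

/-- Every `Q ∈ ℚ[X 0, X 1]` has a formal antiderivative in the variable `X 1` with rational
coefficients: `∂₁ F = Q` for `F = Σ_m coeff_m(Q)/(m₁+1) · X^{m + e₁}`. [folklore] -/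
theorem exists_pderiv_eq (Q : MvPolynomial (Fin 2) ℚ) :
    ∃ F : MvPolynomial (Fin 2) ℚ, pderiv 1 F = Q := by
  refine ⟨∑ m ∈ Q.support, monomial (m + Finsupp.single 1 1) (coeff m Q / (m 1 + 1)), ?_⟩
  rw [map_sum]
  refine (Finset.sum_congr rfl fun m _ => ?_).trans Q.support_sum_monomial_coeff
  rw [pderiv_monomial, add_tsub_cancel_right]
  congr 1
  rw [Finsupp.add_apply, Finsupp.single_eq_same, Nat.cast_succ]
  exact div_mul_cancel₀ _ (Nat.cast_add_one_ne_zero (m 1))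

/-! ### The substituted integrand -/

/-- The integrand `P((y − u(σ))/β, σ)` is the real evaluation at `(y, σ)` of a polynomial
`P̂ ∈ ℚ[X 0, X 1]`, namely `P̂ = P(β⁻¹·(X 0 − u(X 1)), X 1)` (also for `β = 0`, where both sides use
the junk value `β⁻¹ = 0`). [folklore] -/
theorem exists_integrand (u : Polynomial ℚ) (β : ℚ) (P : MvPolynomial (Fin 2) ℚ) :
    ∃ P' : MvPolynomial (Fin 2) ℚ, ∀ y σ : ℝ,
      aeval ![y, σ] P' = aeval ![(y - Polynomial.aeval σ u) / β, σ] P := by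
  refine ⟨bind₁ ![C β⁻¹ * (X 0 - Polynomial.aeval (X 1 : MvPolynomial (Fin 2) ℚ) u), X 1] P,
    fun y σ => ?_⟩
  have hf : (fun i => aeval ![y, σ]
      ((![C β⁻¹ * (X 0 - Polynomial.aeval (X 1 : MvPolynomial (Fin 2) ℚ) u), X 1] :
        Fin 2 → MvPolynomial (Fin 2) ℚ) i)) = ![(y - Polynomial.aeval σ u) / β, σ] := by
    funext i
    fin_cases i
    · show aeval ![y, σ] (C β⁻¹ * (X 0 - Polynomial.aeval (X 1 : MvPolynomial (Fin 2) ℚ) u)) =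
        (y - Polynomial.aeval σ u) / β
      rw [map_mul, map_sub, aeval_C, aeval_X, ← Polynomial.aeval_algHom_apply, aeval_X,
        Matrix.cons_val_zero, Matrix.cons_val_one, Matrix.cons_val_zero, eq_ratCast, Rat.cast_inv,
        div_eq_inv_mul]
    · simp
  rw [aeval_bind₁, hf]

/-! ### The fundamental theorem of calculus along the second variable -/

/-- `σ ↦ Q(y, σ)` is continuous. [folklore] -/
theorem continuous_aeval_snd (Q : MvPolynomial (Fin 2) ℚ) (y : ℝ) :
    Continuous fun t : ℝ => aeval ![y, t] Q :=
  continuous_iff_continuousAt.2 fun t => (LinExact.hasDerivAt_aeval_snd Q y t).continuousAt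

/-- FTC: `∫_{(s,1)} (∂₁F)(y, σ) dσ = F(y, 1) − F(y, s)` for `s ≤ 1`. [folklore] -/
theorem integral_pderiv (F : MvPolynomial (Fin 2) ℚ) (y s : ℝ) (hs : s ≤ 1) :
    ∫ σ in Ioo s 1, aeval ![y, σ] (pderiv 1 F) = aeval ![y, 1] F - aeval ![y, s] F := by
  rw [← integral_Ioc_eq_integral_Ioo, ← intervalIntegral.integral_of_le hs]
  exact intervalIntegral.integral_eq_sub_of_hasDerivAt
    (fun x _ => LinExact.hasDerivAt_aeval_snd F y x)
    ((continuous_aeval_snd (pderiv 1 F) y).intervalIntegrable s 1)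

/-- The set integral `∫_{(s,1)} Q(y, σ) dσ` of a polynomial `Q ∈ ℚ[X 0, X 1]` is, for `s ≤ 1`, the
evaluation at `(y, s)` of the polynomial `H = F(X 0, 1) − F ∈ ℚ[X 0, X 1]`, `F` a formal
antiderivative of `Q` in `X 1`. [folklore] -/
theorem exists_integral_eq (Q : MvPolynomial (Fin 2) ℚ) :
    ∃ H : MvPolynomial (Fin 2) ℚ, ∀ y s : ℝ, s ≤ 1 →
      aeval ![y, s] H = ∫ σ in Ioo s 1, aeval ![y, σ] Q := by
  obtain ⟨F, hF⟩ := exists_pderiv_eq Q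
  refine ⟨bind₁ ![X 0, 1] F - F, fun y s hs => ?_⟩
  have hf : (fun i => aeval ![y, s] ((![X 0, 1] : Fin 2 → MvPolynomial (Fin 2) ℚ) i)) =
      ![y, 1] := by
    funext i
    fin_cases i <;> simp
  have h1 : aeval ![y, s] (bind₁ ![X 0, 1] F) = aeval ![y, 1] F := by
    rw [aeval_bind₁, hf]
  rw [map_sub, h1, ← hF]
  exact (integral_pderiv F y s hs).symm

end GpPolyIntegral

/-- **Graph-pencil class, step GP3a** (stub `stub_gpPolyIntegral` of the crux `TateFamilyKernel`,
line `Sketch`). The single-branch integral `∫_{(s,1)} P((y − u(σ))/β, σ) dσ` is, for `s ≤ 1`, a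
polynomial in `(y, s)` with rational coefficients: there is `H ∈ ℚ[X 0, X 1]` with
`H(y, s) = ∫_{σ ∈ (s,1)} P((y − u(σ))/β, σ) dσ` for all real `y` and all real `s ≤ 1` (termwise
antiderivative of a polynomial in `σ`, then the fundamental theorem of calculus; for `s > 1` the set
integral truncates to `0`, hence the restriction). [folklore] -/
theorem stub_gpPolyIntegral (u : Polynomial ℚ) (β : ℚ) (P : MvPolynomial (Fin 2) ℚ) :
    ∃ H : MvPolynomial (Fin 2) ℚ, ∀ y s : ℝ, s ≤ 1 →
      aeval (![y, s] : Fin 2 → ℝ) H =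
        ∫ σ in Ioo s 1, aeval (![(y - Polynomial.aeval σ u) / β, σ] : Fin 2 → ℝ) P := by
  obtain ⟨P', hP'⟩ := GpPolyIntegral.exists_integrand u β P
  obtain ⟨H, hH⟩ := GpPolyIntegral.exists_integral_eq P'
  refine ⟨H, fun y s hs => ?_⟩
  rw [hH y s hs]
  simp only [hP']

end Summit.KontsevichZagierPeriods.InverseLandau.TateFamilyKernel.Descent
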